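import Literature.AlgebraicGeometry.Resolution.LipmanValuativeQuadraticSequenceDivisorial
import Literature.AlgebraicGeometry.Resolution.LipmanNoEternalNormalisedBranch
import Literature.AlgebraicGeometry.Resolution.NormalCrossingsStrictification
import Literature.AlgebraicGeometry.Resolution.ExcellentRingsFieldProofs
import Literature.AlgebraicGeometry.Resolution.ExcellentRingsEssFiniteType
import Literature.AlgebraicGeometry.Resolution.ExcellentClosedSubschemes
import HarnessLib

/-!
# Lipman's valuative quadratic sequence from the normalised-branch form
# (`Lipman1978NoEternalNormalisedBranch → Lipman1978ValuativeQuadraticSequence`)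

Topic: `Literature/AlgebraicGeometry/Resolution`. Companion of `LipmanValuativeQuadraticSequence.lean` (the
named fact `Lipman1978ValuativeQuadraticSequence`: along a valuation ring `O` of the function field `K` of a
surface over `k`, the NORMALISED quadratic transforms of a normal surface germ reach a regular local ring —
Lipman 1978, THEOREM p. 151 and (1.32)–(1.33) p. 174 = Liu 2002, Thm. 8.3.44, followed along `O`) and of
`LipmanNoEternalNormalisedBranch.lean` (the named fact `Lipman1978NoEternalNormalisedBranch`: the same
theorem followed along ONE BRANCH of closed points of an excellent normal surface germ, the steps being
NORMALISED quadratic transforms `IsNormalisedQuadraticTransform`).  This file PROVES that the second implies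
the first (cell `res-hironaka`, rung L, slot W4.1, `stmt-ResolutionOfSingularities-16345`, res-L0-w41-plan-1
RULING 55a «ONE LIPMAN FACT»: the crux chain's T-line carried both facts as hypotheses; after this file it
carries `Lipman1978NoEternalNormalisedBranch` alone).  Everything here is a theorem; no definition and no
named fact is introduced (D-0026 accounting: 0).

## The argument (one paragraph)

Assume `Lipman1978NoEternalNormalisedBranch` and the data of the valuative fact, and suppose no `R i` is
regular.  By the landed dictionary of `LipmanValuativeQuadraticSequenceProofs.lean`
(`exists_normalSurface_point_range_eq`, `NormalSurface.exists_point_iterate_range_eq`) every `R n` is the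
local ring of a NORMAL SURFACE of finite type over `k` at a point `P_n`; since `R n` is singular, `P_n` is a
singular point, so `dim (R n) ≥ 2` (`Lipman1978ValuativeQuadraticSequence.two_le_ringKrullDim_of_forall_not_isRegularLocalRing`),
and `dim (R n) ≤ dim X_n = 2` (`ringKrullDim_stalk_le_topologicalKrullDim`); `R n` is Noetherian and
integrally closed; `R 0` is excellent (essentially of finite type over the field `k`, `isExcellentRing_of_field`,
`IsExcellentRing.of_essFiniteType`) and a local ring OF `K`.  THE STEP: by the conversions (T1)–(T3) of the
same file (`adjoin_union_toSubring_eq_blowupRing`, `adjoin_setOf_isIntegral_toSubring_eq`,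
`adjoin_mul_inv_toSubring_eq_locAtCentre`) the recursion of the valuative fact reads
`R (n+1) = (N_n)_{𝔪_O ∩ N_n}` for the integral closure `N_n` in `K` of the chart `(R n)[𝔪_n / x_n]` — i.e.
`R (n+1)` is a NORMALISED quadratic transform of `R n` (`IsNormalisedQuadraticTransform`: it is local,
contains `N_n`, its elements are fractions over `N_n` with denominators of value `1`, and it dominates `R n`
because both are dominated by `O`).  So `(R n)` is a branch as in `Lipman1978NoEternalNormalisedBranch`, which
yields a regular member — contradiction.

## References

* J. Lipman, *Desingularization of two-dimensional schemes*, Ann. of Math. 107 (1978) 151–207: THEOREM p. 151,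
  Remark B p. 155, (1.32)–(1.33) p. 174. [Lipman1978]
* M. Artin, *Lipman's proof of resolution of singularities for surfaces*, in Arithmetic Geometry
  (Cornell–Silverman eds.), Springer 1986, 267–287, §1, Thm. (1.1) (held text
  `book:cornellnd-arithmetic-geometry` p0339–p0340, read on the page 2026-08-27). [Artin1986]
* Q. Liu, *Algebraic Geometry and Arithmetic Curves*, OUP 2002, §8.3.4, (3.11) and Thm. 8.3.44. [Liu2002]
-/

noncomputable section

open IsLocalRing AlgebraicGeometry

namespace Literature.AlgebraicGeometry.Resolution

universe u

namespace Lipman1978ValuativeQuadraticSequence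

variable {k K : Type u} [Field k] [Field K] [Algebra k K] (O : ValuationSubring K)

/-! ## §1 Subrings of `K` dominated by `O` and closed under division by units of `O` -/

section DivClosed

/-- A subring `B ⊆ O` of `K` closed under division by the units of `O` it contains is equal to its
localisation at the centre of `O`. [folklore] -/
private theorem locAtCentre_eq_of_divClosed {B : Subring K}
    (hdiv : ∀ y ∈ B, ∀ u ∈ B, O.valuation u = 1 → y * u⁻¹ ∈ B) : locAtCentre B O = B := by
  refine le_antisymm ?_ (le_locAtCentre B O)
  rintro _ ⟨y, hy, z, hz, hvz, rfl⟩
  rw [div_eq_mul_inv]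
  exact hdiv y hy z hz hvz

/-- In a subring `B ⊆ O` of `K` closed under division by the units of `O` it contains, the units are the
elements of value `1`. [folklore] -/
private theorem isUnit_iff_valuation_eq_one {B : Subring K} (hBO : B ≤ O.toSubring)
    (hdiv : ∀ y ∈ B, ∀ u ∈ B, O.valuation u = 1 → y * u⁻¹ ∈ B) (a : B) :
    IsUnit a ↔ O.valuation (a : K) = 1 := by
  rw [isUnit_subring_iff_inv_mem]
  constructor
  · rintro ⟨h0, hinv⟩
    have h1 : O.valuation (a : K) ≤ 1 := (O.valuation_le_one_iff _).mpr (hBO a.2)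
    have h2 : O.valuation ((a : K)⁻¹) ≤ 1 := (O.valuation_le_one_iff _).mpr (hBO hinv)
    rw [map_inv₀, inv_le_one₀ (zero_lt_iff.mpr ((map_ne_zero _).mpr h0))] at h2
    exact le_antisymm h1 h2
  · intro hv
    refine ⟨ne_zero_of_valuation_eq_one hv, ?_⟩
    have := hdiv 1 B.one_mem (a : K) a.2 hv
    rwa [one_mul] at this

/-- Such a subring is a local ring: its non-units, the elements of value `< 1`, are closed under addition.
[folklore] -/
private theorem isLocalRing_of_divClosed {B : Subring K} (hBO : B ≤ O.toSubring)
    (hdiv : ∀ y ∈ B, ∀ u ∈ B, O.valuation u = 1 → y * u⁻¹ ∈ B) : IsLocalRing B := by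
  rw [← locAtCentre_eq_of_divClosed O hdiv]
  exact isLocalRing_locAtCentre hBO

/-- In such a (local) subring the maximal ideal consists of the elements of value `< 1` (domination by `O`).
[folklore] -/
private theorem mem_maximalIdeal_iff_of_divClosed {B : Subring K} [IsLocalRing B] (hBO : B ≤ O.toSubring)
    (hdiv : ∀ y ∈ B, ∀ u ∈ B, O.valuation u = 1 → y * u⁻¹ ∈ B) (a : B) :
    a ∈ maximalIdeal B ↔ O.valuation (a : K) < 1 := by
  rw [IsLocalRing.mem_maximalIdeal, mem_nonunits_iff, isUnit_iff_valuation_eq_one O hBO hdiv]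
  have h1 : O.valuation (a : K) ≤ 1 := (O.valuation_le_one_iff _).mpr (hBO a.2)
  exact ⟨fun h => lt_of_le_of_ne h1 h, fun h => h.ne⟩

end DivClosed

/-! ## §2 The step of the valuative fact is a normalised quadratic transform -/

section Step

/-- **The recursion of `Lipman1978ValuativeQuadraticSequence`, read as a NORMALISED QUADRATIC TRANSFORM.**
Let `R ⊆ O` be a `k`-subalgebra of `K` closed under division by the units of `O` it contains (so `R` is local
and dominated by `O`), `x ∈ R` of value `< 1`, non-zero, of maximal value among the elements of `R` of value
`< 1`, and let `R'` be the next ring of the fact's recursion (in its `Algebra.adjoin` spelling).  Then, with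
`N` the integral closure in `K` of the chart `R[𝔪_R/x]` (`blowupRing`): `R' = N_{𝔪_O ∩ N}` inside `K`
(conversions (T1)–(T3) of `LipmanValuativeQuadraticSequenceProofs.lean`), and `R → R'` is a normalised quadratic
transform (`IsNormalisedQuadraticTransform`): `R'` is local, contains `N`, consists of fractions `a / s` with
`a, s ∈ N` and `s` of value `1` (a unit of `R'`), and dominates `R`.  This is Lipman's "normal transform along
`v`" (1.32) of the valuative fact identified with the step of the branch fact.
[cite: Lipman1978, (1.32) p. 174; Liu2002, §8.3.4 (3.11)] -/
theorem isNormalisedQuadraticTransform_step (hk : ∀ c : k, algebraMap k K c ∈ O) {R R' : Subalgebra k K}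
    {x : K} (hRO : R.toSubring ≤ O.toSubring)
    (hdiv : ∀ y ∈ R, ∀ u ∈ R, O.valuation u = 1 → y * u⁻¹ ∈ R)
    (hxR : x ∈ R) (hvx : O.valuation x < 1) (hx0 : x ≠ 0)
    (hxmax : ∀ y ∈ R, O.valuation y < 1 → O.valuation y ≤ O.valuation x)
    (hR' : R' =
      Algebra.adjoin k {y : K | ∃ a ∈ Algebra.adjoin k {z : K | IsIntegral
          ↥(Algebra.adjoin k ((R : Set K) ∪
            {w : K | ∃ a ∈ R, O.valuation a < 1 ∧ w = a * x⁻¹})) z},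
        ∃ s ∈ Algebra.adjoin k {z : K | IsIntegral
          ↥(Algebra.adjoin k ((R : Set K) ∪
            {w : K | ∃ a ∈ R, O.valuation a < 1 ∧ w = a * x⁻¹})) z},
        s⁻¹ ∈ O ∧ y = a * s⁻¹}) :
    IsNormalisedQuadraticTransform R.toSubring R'.toSubring := by
  have hdiv' : ∀ y ∈ R.toSubring, ∀ u ∈ R.toSubring, O.valuation u = 1 → y * u⁻¹ ∈ R.toSubring :=
    fun y hy u hu hvu => hdiv y hy u hu hvu
  haveI hRloc : IsLocalRing R.toSubring := isLocalRing_of_divClosed O hRO hdiv'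
  have hdom : ∀ a : R.toSubring, a ∈ maximalIdeal R.toSubring ↔ O.valuation (a : K) < 1 :=
    mem_maximalIdeal_iff_of_divClosed O hRO hdiv'
  -- the three rings of the recursion
  set B : Subalgebra k K := Algebra.adjoin k ((R : Set K) ∪
    {w : K | ∃ a ∈ R, O.valuation a < 1 ∧ w = a * x⁻¹}) with hB
  set IC : Subalgebra k K := Algebra.adjoin k {z : K | IsIntegral B z} with hIC
  -- (T1) `B = R[𝔪_R/x]`
  have hT1 : B.toSubring = blowupRing R.toSubring x := adjoin_union_toSubring_eq_blowupRing O R hdom x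
  -- `B ⊆ O`: `x` has maximal value among the non-units
  obtain ⟨hR'O, hR'div, hRR', -⟩ := step_props O hk hRO hxmax hR'
  have hBO : B.toSubring ≤ O.toSubring := by
    rw [hB]
    refine adjoin_toSubring_le_valuationSubring O hk ?_
    rintro w (hw | ⟨a, ha, hva, rfl⟩)
    · exact hRO hw
    · change a * x⁻¹ ∈ O
      rw [← O.valuation_le_one_iff, map_mul, map_inv₀,
        mul_inv_le_iff₀ (zero_lt_iff.mpr ((map_ne_zero _).mpr hx0)), one_mul]
      exact hxmax a ha hva
  -- (T2) `IC` is the integral closure of `B` in `K`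
  have hT2 : IC.toSubring = (integralClosure B.toSubring K).toSubring :=
    adjoin_setOf_isIntegral_toSubring_eq B
  -- `IC ⊆ O`
  have hICO : IC.toSubring ≤ O.toSubring :=
    adjoin_toSubring_le_valuationSubring O hk fun z hz =>
      mem_valuationSubring_of_isIntegral O hBO hz
  -- (T3) `R' = IC_{𝔪_O ∩ IC}`
  have hT3 : R'.toSubring = locAtCentre IC.toSubring O := by
    rw [hR']
    exact adjoin_mul_inv_toSubring_eq_locAtCentre O IC hICO
  -- the integral closure `N` of the chart, as a subring of `K`
  have hN : (integralClosure (blowupRing R.toSubring ((⟨x, hxR⟩ : R.toSubring) : K)) K).toSubring =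
      IC.toSubring := by
    change (integralClosure (blowupRing R.toSubring x) K).toSubring = IC.toSubring
    rw [hT2, hT1]
  refine ⟨hRloc, ⟨x, hxR⟩, (hdom _).mpr hvx, fun h => hx0 (congrArg Subtype.val h), ?_, ?_, ?_, ?_⟩
  · -- `R'` is local
    exact isLocalRing_of_divClosed O hR'O fun y hy u hu hvu => hR'div y hy u hu hvu
  · -- `N ≤ R'`
    rw [hN, hT3]
    exact le_locAtCentre _ O
  · -- fractions over `N`
    intro z hz
    rw [hT3, mem_locAtCentre_iff] at hz
    obtain ⟨a, ha, s, hs, hvs, rfl⟩ := hz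
    refine ⟨a, hN ▸ ha, s, hN ▸ hs, ?_, rfl⟩
    rw [hT3]
    exact inv_mem_locAtCentre (le_locAtCentre _ O hs) hvs
  · -- `R'` dominates `R`
    refine ⟨fun z hz => hRR' hz, fun u hu huinv => ?_⟩
    rcases eq_or_ne u 0 with rfl | hu0
    · rw [inv_zero]; exact R.toSubring.zero_mem
    have hvu : O.valuation u = 1 := by
      have h1 : O.valuation u ≤ 1 := (O.valuation_le_one_iff _).mpr (hRO hu)
      have h2 : O.valuation u⁻¹ ≤ 1 := (O.valuation_le_one_iff _).mpr (hR'O huinv)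
      rw [map_inv₀, inv_le_one₀ (zero_lt_iff.mpr ((map_ne_zero _).mpr hu0))] at h2
      exact le_antisymm h1 h2
    have := hdiv 1 R.one_mem u hu hvu
    rwa [one_mul] at this

end Step

/-! ## §3 The derivation -/

section Derivation

/-- **`Lipman1978NoEternalNormalisedBranch` implies `Lipman1978ValuativeQuadraticSequence`.**  Suppose no
`R i` is regular.  The dictionary of `LipmanValuativeQuadraticSequenceProofs.lean` realises every `R n` as the
local ring of a normal surface of finite type over `k` at a SINGULAR point, so `R n` is a Noetherian,
integrally closed local ring of `K` of Krull dimension exactly `2` (`≥ 2` at a singular point of a normal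
surface, `≤ 2 = dim X_n`); `R 0` is excellent (essentially of finite type over a field) with fraction field
`K`; and each step is a normalised quadratic transform (`isNormalisedQuadraticTransform_step`).  The branch
fact then produces a regular `R m` — contradiction.  Hence the valuative fact; the crux chain's slate may feed
`hLV := hL'.of_normalisedBranch`. [cite: Lipman1978, Thm. p. 151, (1.32)–(1.33) p. 174; Artin1986, Thm. (1.1)
p. 267; Liu2002, Thm. 8.3.44] -/
theorem of_normalisedBranch (h : Lipman1978NoEternalNormalisedBranch.{u}) :
    Lipman1978ValuativeQuadraticSequence.{u} := by
  intro k K _ _ _ O R x hk htr hess hfrac hRO hloc hnorm hstep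
  by_contra hcon
  push Not at hcon
  haveI := hfrac
  -- bookkeeping `R n ≃+* (R n).toSubring` between the `Subalgebra` and `Subring` spellings
  have e₀ : ∀ n, ↥(R n) ≃+* ↥(R n).toSubring := fun n =>
    { toFun := fun z => ⟨z.1, z.2⟩, invFun := fun z => ⟨z.1, z.2⟩, left_inv := fun _ => rfl,
      right_inv := fun _ => rfl, map_mul' := fun _ _ => rfl, map_add' := fun _ _ => rfl }
  -- the initial model: `R 0` is the local ring of a normal surface at a point
  obtain ⟨S, P, ψ, hψ, hR⟩ := exists_normalSurface_point_range_eq O (R 0) htr hess hfrac hRO hloc hnorm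
  have hinvR : ∀ s ∈ R 0, O.valuation s = 1 → s⁻¹ ∈ R 0 := by
    intro s hs hvs
    rw [← hloc]
    exact Algebra.subset_adjoin ⟨1, (R 0).one_mem, s, hs, inv_mem_of_valuation_eq_one O hvs,
      by rw [one_mul]⟩
  have hmemR : ∀ r, ψ r ∈ R 0 := fun r => show ψ r ∈ (R 0).toSubring from hR ▸ ⟨r, rfl⟩
  have hdom0 : ∀ r, r ∈ maximalIdeal (S.X.presheaf.stalk P) ↔ O.valuation (ψ r) < 1 := by
    intro r
    rw [IsLocalRing.mem_maximalIdeal, mem_nonunits_iff]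
    have hle : O.valuation (ψ r) ≤ 1 := (O.valuation_le_one_iff _).mpr (hRO (hmemR r))
    constructor
    · intro hnu
      refine lt_of_le_of_ne hle fun h1 => hnu ?_
      obtain ⟨t, ht⟩ : (ψ r)⁻¹ ∈ ψ.range := hR ▸ (hinvR _ (hmemR r) h1)
      have h0 : ψ r ≠ 0 := ne_zero_of_valuation_eq_one h1
      have hrt : r * t = 1 := hψ (by rw [map_mul, ht, mul_inv_cancel₀ h0, map_one])
      exact ⟨⟨r, t, hrt, by rwa [mul_comm] at hrt⟩, rfl⟩
    · rintro hlt ⟨u, rfl⟩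
      have h1 : O.valuation (ψ ↑u) * O.valuation (ψ ↑u⁻¹) = 1 := by
        rw [← map_mul, ← map_mul, Units.mul_inv, map_one, map_one]
      have h2 : O.valuation (ψ ↑u⁻¹) ≤ 1 := (O.valuation_le_one_iff _).mpr (hRO (hmemR _))
      have : O.valuation (ψ ↑u) * O.valuation (ψ ↑u⁻¹) < 1 * 1 :=
        mul_lt_mul_of_lt_of_le_of_nonneg_of_pos hlt h2 zero_le zero_lt_one
      rw [h1, one_mul] at this
      exact lt_irrefl _ this
  have hfrac0 : ∀ z : K, ∃ a b : S.X.presheaf.stalk P, z = ψ a / ψ b := by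
    intro z
    obtain ⟨a, b, -, rfl⟩ := IsFractionRing.div_surjective (A := R 0) z
    obtain ⟨a', ha'⟩ : (a : K) ∈ ψ.range := hR ▸ a.2
    obtain ⟨b', hb'⟩ : (b : K) ∈ ψ.range := hR ▸ b.2
    exact ⟨a', b', by rw [ha', hb']; rfl⟩
  -- every member is the local ring of a normal surface at a singular point
  have hmember : ∀ n, IsLocalRing (R n).toSubring ∧ IsNoetherianRing (R n).toSubring ∧
      IsIntegrallyClosed (R n).toSubring ∧ ringKrullDim (R n).toSubring = 2 := by
    intro n
    obtain ⟨P', ψ', hψ', hrange'⟩ := NormalSurface.exists_point_iterate_range_eq O R x hcon hstep n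
      0 S P ψ hψ hR hRO hdom0 hfrac0
    rw [Nat.zero_add] at hrange'
    haveI := (NormalSurface.step^[n] S).isNoetherian_X
    have hmem : ∀ r, ψ' r ∈ R n := fun r => show ψ' r ∈ (R n).toSubring from hrange' ▸ ⟨r, rfl⟩
    let e' : (NormalSurface.step^[n] S).X.presheaf.stalk P' ≃+* ↥(R n) :=
      RingEquiv.ofBijective (ψ'.codRestrict (R n) hmem)
        ⟨fun a b hab => hψ' (congrArg Subtype.val hab), fun z => by
          obtain ⟨r, hr⟩ : (z : K) ∈ ψ'.range := hrange' ▸ z.2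
          exact ⟨r, Subtype.ext hr⟩⟩
    let e : (NormalSurface.step^[n] S).X.presheaf.stalk P' ≃+* (R n).toSubring :=
      e'.trans (e₀ n)
    have hP' : P' ∉ Scheme.regularLocus (NormalSurface.step^[n] S).X := fun hreg =>
      hcon n ((isRegularLocalRing_iff_of_range_eq ψ' hψ' (R n) hrange').mp hreg)
    have h2 := two_le_ringKrullDim_stalk_of_not_mem_regularLocus (NormalSurface.step^[n] S).normal hP'
    have h2' : ringKrullDim ((NormalSurface.step^[n] S).X.presheaf.stalk P') ≤ 2 :=
      (ringKrullDim_stalk_le_topologicalKrullDim (NormalSurface.step^[n] S).X P').trans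
        (NormalSurface.step^[n] S).dim_eq.le
    haveI : IsIntegrallyClosed ((NormalSurface.step^[n] S).X.presheaf.stalk P') :=
      (NormalSurface.step^[n] S).normal P'
    refine ⟨e.isLocalRing, isNoetherianRing_of_ringEquiv _ e, IsIntegrallyClosed.of_equiv e, ?_⟩
    rw [← ringKrullDim_eq_of_ringEquiv e]
    exact le_antisymm h2' h2
  -- the sequence read in `K`: inside `O`, division-closed, increasing, with the step data
  have hseq := seq_props O hk R x hRO hloc hcon hstep
  -- `K` is the field of fractions of `R 0`
  have hof : IsLocalRingOf (R 0).toSubring := by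
    refine ⟨(hmember 0).1, fun z => ?_⟩
    obtain ⟨a, b, hb, rfl⟩ := IsFractionRing.div_surjective (A := R 0) z
    exact ⟨a, a.2, b, b.2, fun h => nonZeroDivisors.coe_ne_zero ⟨b, hb⟩ (Subtype.ext h), rfl⟩
  -- `R 0` is excellent: essentially of finite type over the field `k`
  have hexc : IsExcellentRing (R 0).toSubring :=
    ((isExcellentRing_of_field k).of_essFiniteType hess).of_ringEquiv (e₀ 0)
  -- the step is a normalised quadratic transform
  have hNT : ∀ n, IsNormalisedQuadraticTransform (R n).toSubring (R (n + 1)).toSubring := by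
    intro n
    obtain ⟨hRnO, hRndiv, -, -⟩ := hseq n
    obtain ⟨hxR, hvx, hxmax, hRsucc⟩ := hstep n (hcon n)
    have hx0 : x n ≠ 0 := by
      intro hx0
      -- all elements of value `< 1` of `R n` vanish, so `R n` is a field, hence regular
      refine hcon n (isRegularLocalRing_of_isField ?_)
      haveI := (hmember n).1
      refine MulEquiv.isField (IsLocalRing.isField_iff_maximalIdeal_eq.mpr ?_)
        (e₀ n).toMulEquiv
      rw [eq_bot_iff]
      intro a ha
      rw [mem_maximalIdeal_iff_of_divClosed O hRnO (fun y hy u hu hvu => hRndiv y hy u hu hvu)] at ha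
      have hva : O.valuation (a : K) ≤ O.valuation (x n) := hxmax a a.2 ha
      rw [hx0, map_zero, le_zero_iff, map_eq_zero] at hva
      exact (Submodule.mem_bot _).mpr (Subtype.ext hva)
    exact isNormalisedQuadraticTransform_step O hk hRnO
      (fun y hy u hu hvu => hRndiv y hy u hu hvu) hxR hvx hx0 hxmax hRsucc
  -- apply the branch fact to `n ↦ (R n).toSubring`
  obtain ⟨m, hm⟩ := h K (fun n => (R n).toSubring) hof (hmember 0).2.1 hexc hNT
    (fun n => (hmember n).2.2.1) (fun n => (hmember n).2.2.2)
  -- contradiction: `R m` is regular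
  refine hcon m ?_
  haveI := hm
  exact IsRegularLocalRing.of_ringEquiv (e₀ m).symm

end Derivation

end Lipman1978ValuativeQuadraticSequence

/-- **ONE LIPMAN FACT for the crux chain's slate** (root-namespace alias of
`Lipman1978ValuativeQuadraticSequence.of_normalisedBranch`): the normalised-branch form of Lipman's theorem
implies its valuative form. [cite: Lipman1978, Thm. p. 151, (1.32)–(1.33) p. 174; Artin1986, Thm. (1.1)] -/
theorem Lipman1978NoEternalNormalisedBranch.toValuativeQuadraticSequence
    (h : Lipman1978NoEternalNormalisedBranch.{u}) : Lipman1978ValuativeQuadraticSequence.{u} :=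
  Lipman1978ValuativeQuadraticSequence.of_normalisedBranch h

end Literature.AlgebraicGeometry.Resolution

end
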